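import Summits.KontsevichZagierPeriods.KontsevichZagierPeriods.Theses.FurushoPentagon
import Summits.KontsevichZagierPeriods.KontsevichZagierPeriods.Theses.LinRedNormalForm

/-!
# Crux `OffMzvSectorComplement` (child 2 of the glued split of `FurushoPentagon.KernelModuloPeriodConjecture`,
stmt-KontsevichZagierPeriods-15058) — line `genus-zero-funnel`, birth skeleton (planner-cstrat, 2026-08-17)

The crux O (the OFF-SECTOR COMPLEMENT, declared NOT CLAIMED by route FurushoPentagon): Conjecture 1 in
kernel form on the subgroup of `KZ.FormalRep` generated by the simplex classes `[Δ_s, ∏ ω_ε]` of the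
multiple zeta values IMPLIES Conjecture 1 in kernel form, `∀ c, KZ.eval c = 0 → c ∈ KZ.relations`.
Logical position (parent `Disproof.lean` §5, `not_stubO_iff`): `¬O ↔ MzvSectorKernel ∧ ¬summit` — it
is summit-implied, unkillable while the MZV sector holds, and it is Conjecture 1 OFF the sector.

THE LINE (uses O's hypothesis essentially): funnel every vanishing combination into the MZV sector
through GENUS ZERO, along the two existing items of route LinRedNormalForm, then spend the hypothesis.
Registered stubs:
* `stub_residualBeyondGenusZero` — R = item stmt-KontsevichZagierPeriods-3917
  `LinRedNormalForm.ResidualBeyondGenusZero` BY NAME (every vanishing formal combination is congruent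
  modulo `KZ.relations` to a `ℤ`-combination of genus-zero reps `[Δ_k, P/(∏tᵢ^{bᵢ}∏(1−tᵢ)^{cᵢ}∏(tᵢ−tⱼ)^{aᵢⱼ})]`;
  summit-strength OFF genus zero — LinRedNormalForm's declared residual, owned by routes NoriTransfer /
  Grothendieck / AyoubSpecialisation; this is where O's summit-hardness honestly sits);
* `stub_dihedralNormalForm` — N = item stmt-KontsevichZagierPeriods-3912 `LinRedNormalForm.DihedralNormalForm`
  BY NAME (rank-2 crux of LinRedNormalForm, OPEN, staffed: every genus-zero rep is KZ-equivalent to a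
  `ℤ`-combination of MZV word reps `[Δ_w, q·∏ω_ε]`; value-level shadow = Brown, Ann. ENS 2009, Thm 1.1);
* `stub_mzvKernelInKZ_of_simplexSectorKernel` — B, the BRIDGE (provable now, size M): the kernel form on
  the simplex-class sector (O's hypothesis, `KZ.mzvRep` classes, `ℤ`-coefficients) gives the kernel form
  on the word-rep sector of LinRedNormalForm (item 3914 `MzvKernelInKZ`: generators `[Δ_w, q·∏ω_ε]`,
  `q ∈ ℚ`): clear denominators by integrand additivity (`N•[Δ, (a/N)ω] ≡ a•[Δ, ω]`), identify `[Δ_w, ∏ω_ε]`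
  with `KZ.mzvRep (ofBinaryWord ε)` (tree `KZ.wordRep_bword_eq_mzvRep`-type calibration), apply the
  hypothesis to `N•m`, divide by `N` with the PROVED `FurushoPentagon.IntegerDivision`.
Composition `OffMzvSectorComplement_of` (proved, no sorry): for `eval c = 0`, R gives `c ≡ c₀` (genus
zero), N extended additively over the closure gives `c₀ ≡ m` (MZV words), soundness gives `eval m = 0`,
B with the hypothesis gives `m ∈ relations`, and `c = (c − c₀) + (c₀ − m) + m`.

Second line (recorded, registered separately as `kernel-form-bypass`): O also follows, WITHOUT its
hypothesis, from the kernel form itself, whose live programme is crux stmt-10813's line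
`effective_cube_surjection` = items stmt-17978 `HermiteRigidity.CubeResolution` + stmt-18116
`HermiteRigidity.AyoubEffectiveCubeKernel` (composition landed: `HermiteRigidity.ReductionRigidityOfCubes.kernelForm_of_cubes`).

References: M. Kontsevich, D. Zagier, *Periods* (2001) §1.2; F. Brown, Ann. Sci. ÉNS 42 (2009) Thm 1.1;
F. Brown, Ann. of Math. 175 (2012) Thm 1.1; J. Ayoub, Ann. of Math. 181 (2015) Conj. 1.1.
-/

noncomputable section

set_option linter.dupNamespace false

namespace Summit.KontsevichZagierPeriods.KontsevichZagierPeriods.Cruxes.OffMzvSectorComplement.GenusZeroFunnel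

open Literature.NumberTheory.Transcendental
open Summit.KontsevichZagierPeriods.KontsevichZagierPeriods.Theses

/-- PRE-SPLIT COPY of the child crux, verbatim the statement filed in children.json (replaced by the
route decl `…Theses.FurushoPentagon.OffMzvSectorComplement` once the gate has written it). -/
def OffMzvSectorComplement : Prop :=
  (∀ c ∈ AddSubgroup.closure (Set.range (fun s : {s : List ℕ // Literature.NumberTheory.Transcendental.MZV.IsAdmissible s} => Literature.NumberTheory.Transcendental.KZ.of (Literature.NumberTheory.Transcendental.KZ.mzvRep s.1 s.2 (Literature.NumberTheory.Transcendental.KZ.mzvIntegrand_isSemialgebraicFunOn_holds s.1) (Literature.NumberTheory.Transcendental.KZ.mzvIntegrand_integrableOn_holds s.1 s.2)))), Literature.NumberTheory.Transcendental.KZ.eval c = 0 → c ∈ Literature.NumberTheory.Transcendental.KZ.relations) → ∀ c : Literature.NumberTheory.Transcendental.KZ.FormalRep, Literature.NumberTheory.Transcendental.KZ.eval c = 0 → c ∈ Literature.NumberTheory.Transcendental.KZ.relations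

/-! ## Registered stubs -/

/-- **R — the genus-zero residual** (= item stmt-KontsevichZagierPeriods-3917
`LinRedNormalForm.ResidualBeyondGenusZero`, by name): every vanishing formal combination is congruent
modulo `KZ.relations` to a `ℤ`-combination of genus-zero (`M_{0,n}`-cellular) reps. Summit-strength off
genus zero; the declared residual of route LinRedNormalForm. [cite: KontsevichZagier2001, §1.2] -/
theorem stub_residualBeyondGenusZero : LinRedNormalForm.ResidualBeyondGenusZero := by
  sorry

/-- **N — the dihedral normal form** (= item stmt-KontsevichZagierPeriods-3912
`LinRedNormalForm.DihedralNormalForm`, by name): every absolutely convergent genus-zero rep is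
KZ-equivalent to a `ℤ`-combination of MZV word reps `[Δ_w, q·∏ω_ε]`. OPEN, staffed (rank-2 crux of
LinRedNormalForm); value-level shadow is Brown's theorem on periods of `M_{0,n}`. [cite: BrownENS2009, Thm 1.1] -/
theorem stub_dihedralNormalForm : LinRedNormalForm.DihedralNormalForm := by
  sorry

/-- **B — the bridge** (provable now): the kernel form on the SIMPLEX-CLASS sector (O's hypothesis:
`ℤ`-combinations of the classes `KZ.of (KZ.mzvRep s)`, `s` admissible) implies the kernel form on the
WORD-REP sector of LinRedNormalForm (item stmt-KontsevichZagierPeriods-3914 `MzvKernelInKZ`: generators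
`[Δ_w, q·∏ω_ε]`, `q ∈ ℚ`, any rep with that domain and integrand). Clear denominators by integrand
additivity, calibrate `[Δ_w, ∏ω_ε]` against `KZ.mzvRep (MZV.ofBinaryWord ε)` (same domain, same
integrand on the domain ⇒ congruent), apply the hypothesis to `N • m`, and divide by `N` with the proved
`FurushoPentagon.IntegerDivision`. [cite: KontsevichZagier2001, §1.2] -/
theorem stub_mzvKernelInKZ_of_simplexSectorKernel :
    (∀ c ∈ AddSubgroup.closure (Set.range (fun s : {s : List ℕ // MZV.IsAdmissible s} => KZ.of (KZ.mzvRep s.1 s.2 (KZ.mzvIntegrand_isSemialgebraicFunOn_holds s.1) (KZ.mzvIntegrand_integrableOn_holds s.1 s.2)))), KZ.eval c = 0 → c ∈ KZ.relations) →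
      LinRedNormalForm.MzvKernelInKZ := by
  sorry

/-! ## The crux from the stubs, by name -/

/-- Additive extension of a generatorwise congruence over an `AddSubgroup.closure` (as in
`LinRedNormalForm.closes`). [folklore] -/
theorem closure_congr_extend {S T : Set KZ.FormalRep} (c : KZ.FormalRep) (hc : c ∈ AddSubgroup.closure S)
    (hS : ∀ x ∈ S, ∃ m ∈ AddSubgroup.closure T, x - m ∈ KZ.relations) :
    ∃ m ∈ AddSubgroup.closure T, c - m ∈ KZ.relations := by
  induction hc using AddSubgroup.closure_induction with
  | mem x hx => exact hS x hx
  | zero => exact ⟨0, zero_mem _, by simp⟩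
  | add x y _ _ ihx ihy =>
    obtain ⟨m₁, hm₁, h₁⟩ := ihx
    obtain ⟨m₂, hm₂, h₂⟩ := ihy
    refine ⟨m₁ + m₂, add_mem hm₁ hm₂, ?_⟩
    have key := add_mem h₁ h₂
    rwa [show x - m₁ + (y - m₂) = x + y - (m₁ + m₂) by abel] at key
  | neg x _ ih =>
    obtain ⟨m, hm, h⟩ := ih
    refine ⟨-m, neg_mem hm, ?_⟩
    have key := neg_mem h
    rwa [show -(x - m) = -x - -m by abel] at key

/-- **`OffMzvSectorComplement` from the three stubs (R, N, B).** Given the MZV simplex-sector kernel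
and `eval c = 0`: R gives `c ≡ c₀` with `c₀` in the genus-zero closure; N, extended additively, gives
`c₀ ≡ m` with `m` in the MZV-word closure; soundness (`KZ.relations_le_ker_eval_holds`) gives
`eval m = 0`; B turns the hypothesis into the word-sector kernel, so `m ∈ relations`; finally
`c = (c − c₀) + (c₀ − m) + m`. [cite: KontsevichZagier2001, §1.2] -/
theorem offMzvSectorComplement_of_funnel :
    LinRedNormalForm.ResidualBeyondGenusZero →
    LinRedNormalForm.DihedralNormalForm →
    ((∀ c ∈ AddSubgroup.closure (Set.range (fun s : {s : List ℕ // MZV.IsAdmissible s} => KZ.of (KZ.mzvRep s.1 s.2 (KZ.mzvIntegrand_isSemialgebraicFunOn_holds s.1) (KZ.mzvIntegrand_integrableOn_holds s.1 s.2)))), KZ.eval c = 0 → c ∈ KZ.relations) →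
      LinRedNormalForm.MzvKernelInKZ) →
    OffMzvSectorComplement := by
  intro hRES hDNF hBR hM c hc
  have hsound : ∀ x ∈ KZ.relations, KZ.eval x = 0 := fun x hx =>
    (AddMonoidHom.mem_ker).1 (KZ.relations_le_ker_eval_holds hx)
  obtain ⟨c₀, hc₀, h₁⟩ := hRES c hc
  obtain ⟨m, hm, h₂⟩ := closure_congr_extend c₀ hc₀ (fun x hx => by
    obtain ⟨k, r, p, a, b, c', hd, hi, rfl⟩ := hx
    exact hDNF k r p a b c' hd hi)
  have hm0 : KZ.eval m = 0 := by
    have e1 := hsound _ h₁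
    have e2 := hsound _ h₂
    rw [map_sub] at e1 e2
    linarith
  have hmrel : m ∈ KZ.relations := hBR hM m hm hm0
  have hsplit : c = (c - c₀) + (c₀ - m) + m := by abel
  rw [hsplit]
  exact add_mem (add_mem h₁ h₂) hmrel

/-- **The child crux from the registered stubs, by name** (the skeleton's concluding theorem). [folklore] -/
theorem OffMzvSectorComplement_of : OffMzvSectorComplement :=
  offMzvSectorComplement_of_funnel stub_residualBeyondGenusZero stub_dihedralNormalForm
    stub_mzvKernelInKZ_of_simplexSectorKernel

end Summit.KontsevichZagierPeriods.KontsevichZagierPeriods.Cruxes.OffMzvSectorComplement.GenusZeroFunnel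

end
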